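import Literature.Probability.LatticeModels.MedialInterfaceProofs
import Literature.Probability.LatticeModels.InnerFacesHoleFree
import Literature.Probability.RandomPlanarGeometry.JordanDomainInterior
import Literature.Probability.Percolation.BoxCrossingProofs
import HarnessLib

/-!
# Closed inner faces of a discretised Jordan domain lie in its closure: stub
`stub_kernel_innerFace_subset_closure` (K4) of line `hitting-tournament` for crux `LagHandOff`
(stmt-CriticalPhenomena-10268)

The topological brick of the contact kernel of seat c5.  For a Jordan domain `D` and discrete
Dobrushin data `E` with `E.Ω = D.carrier` and positive mesh `δ = E.δ`, the CLOSED mesh square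
`[δ f₀, δ (f₀ + 1)] × [δ f₁, δ (f₁ + 1)]` of an inner face `f` of `Ω_δ` (`E.IsInnerFace f`,
`Literature/Probability/LatticeModels/MedialInterface.lean`: every side of `f` is an edge of
`Ω_δ`) lies in `closure D.carrier`.

Proof.

* The four sides of the square are the segments between the mesh points of lattice-adjacent
  corners of `f`; by `IsInnerFace` these are edges of `Ω_δ`, hence of the mesh graph, so each
  side lies in `closure Ω` (`segment_subset_closure_of_isInnerFace`,
  `Literature/Probability/LatticeModels/InnerFacesHoleFree.lean`).  In coordinates: a point with
  abscissa `δ f₀` or `δ (f₀ + 1)` and ordinate in `[δ f₁, δ (f₁ + 1)]` lies on a vertical side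
  (`mem_closure_of_re_eq_side`), and symmetrically for the horizontal sides
  (`mem_closure_of_im_eq_side`).
* An axis-parallel closed rectangle whose four sides lie in `closure D` lies in `closure D`
  (`closedRect_subset_closure_of_sides`): its open part lies in `D` by the Jordan curve theorem
  (`JordanDomain.openRect_subset_of_sides_subset_closure`,
  `Literature/Probability/RandomPlanarGeometry/JordanDomainInterior.lean`, which feeds the tree's
  proof `JordanCurveTheorem_holds` into the connectedness of the exterior `(closure D)ᶜ`), and a
  point of the closed rectangle off its open part is on one of the four sides.

Only `InnerFacesHoleFree.lean` (`segment_subset_closure_of_isInnerFace`, `meshPoint_vec`,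
`mem_segment_of_re_eq`, `mem_segment_of_im_eq`, `eq_or_eq_of_mem_Icc_of_not_mem_Ioo`),
`JordanDomainInterior.lean` and Mathlib's `reProdIm` API are used.  Helpers live in the
sub-namespace `KernelInnerFaceClosure`.
-/

noncomputable section

open Set Metric
open Literature.Probability.Percolation Literature.Probability.LatticeModels
open Literature.Probability.RandomPlanarGeometry

namespace Summit.CriticalPhenomena.CardyFormulaZ2.Cruxes.LagHandOff.HittingTournament

namespace KernelInnerFaceClosure

/-! ### The sides of an inner face lie in `closure Ω` -/

/-- **Vertical sides.** A point whose abscissa is `δ (f₀ + σ)` (`σ = 0` or `1`) and whose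
ordinate lies in `[δ f₁, δ (f₁ + 1)]` is on the segment between the mesh points of the two
lattice-adjacent corners `(f₀ + σ, f₁)`, `(f₀ + σ, f₁ + 1)` of the inner face `f`, an edge of
`Ω_δ`, hence lies in `closure Ω`. -/
theorem mem_closure_of_re_eq_side {E : DiscreteDobrushin} (hδ : 0 < E.δ) {f : Site 2}
    (hf : E.IsInnerFace f) {σ : ℤ} (hσ : σ = 0 ∨ σ = 1) {z : ℂ}
    (hre : z.re = E.δ * ((f 0 : ℝ) + σ)) (h1 : E.δ * (f 1 : ℝ) ≤ z.im)
    (h2 : z.im ≤ E.δ * ((f 1 : ℝ) + 1)) : z ∈ closure E.Ω := by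
  have hv : IsCorner ![f 0 + σ, f 1] f := by
    intro i; fin_cases i
    · rcases hσ with rfl | rfl <;> simp
    · simp
  have hw : IsCorner ![f 0 + σ, f 1 + 1] f := by
    intro i; fin_cases i
    · rcases hσ with rfl | rfl <;> simp
    · simp
  have hadj : (zdGraph 2).Adj ![f 0 + σ, f 1] ![f 0 + σ, f 1 + 1] :=
    (zdGraph_adj_iff _ _).2 ⟨1, Or.inl (funext fun i => by fin_cases i <;> simp)⟩
  refine segment_subset_closure_of_isInnerFace hf hv hw hadj ?_
  rw [meshPoint_vec, meshPoint_vec]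
  have hlt : E.δ * (f 1 : ℝ) < E.δ * ((f 1 : ℝ) + 1) := by nlinarith
  convert mem_segment_of_re_eq hlt ⟨h1, h2⟩ hre using 2
  · apply Complex.ext <;> push_cast <;> ring
  · apply Complex.ext <;> push_cast <;> ring

/-- **Horizontal sides.** A point whose ordinate is `δ (f₁ + σ)` (`σ = 0` or `1`) and whose
abscissa lies in `[δ f₀, δ (f₀ + 1)]` is on the segment between the mesh points of the two
lattice-adjacent corners `(f₀, f₁ + σ)`, `(f₀ + 1, f₁ + σ)` of the inner face `f`, hence lies in
`closure Ω`. -/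
theorem mem_closure_of_im_eq_side {E : DiscreteDobrushin} (hδ : 0 < E.δ) {f : Site 2}
    (hf : E.IsInnerFace f) {σ : ℤ} (hσ : σ = 0 ∨ σ = 1) {z : ℂ}
    (him : z.im = E.δ * ((f 1 : ℝ) + σ)) (h1 : E.δ * (f 0 : ℝ) ≤ z.re)
    (h2 : z.re ≤ E.δ * ((f 0 : ℝ) + 1)) : z ∈ closure E.Ω := by
  have hv : IsCorner ![f 0, f 1 + σ] f := by
    intro i; fin_cases i
    · simp
    · rcases hσ with rfl | rfl <;> simp
  have hw : IsCorner ![f 0 + 1, f 1 + σ] f := by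
    intro i; fin_cases i
    · simp
    · rcases hσ with rfl | rfl <;> simp
  have hadj : (zdGraph 2).Adj ![f 0, f 1 + σ] ![f 0 + 1, f 1 + σ] :=
    (zdGraph_adj_iff _ _).2 ⟨0, Or.inl (funext fun i => by fin_cases i <;> simp)⟩
  refine segment_subset_closure_of_isInnerFace hf hv hw hadj ?_
  rw [meshPoint_vec, meshPoint_vec]
  have hlt : E.δ * (f 0 : ℝ) < E.δ * ((f 0 : ℝ) + 1) := by nlinarith
  convert mem_segment_of_im_eq hlt ⟨h1, h2⟩ him using 2
  · apply Complex.ext <;> push_cast <;> ring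
  · apply Complex.ext <;> push_cast <;> ring

/-! ### Closed rectangles fenced by `closure D` -/

/-- **Closed rectangles with sides in the closure.** If the four sides of the axis-parallel
rectangle `[x₁, x₂] × [y₁, y₂]` lie in `closure D` for a Jordan domain `D`, the CLOSED rectangle
lies in `closure D`: its open part lies in `D` (Jordan curve theorem,
`JordanDomain.openRect_subset_of_sides_subset_closure`), and a point of the closed rectangle off
the open one is on a side. -/
theorem closedRect_subset_closure_of_sides (D : JordanDomain) {x₁ x₂ y₁ y₂ : ℝ}
    (hv : ∀ z : ℂ, (z.re = x₁ ∨ z.re = x₂) → y₁ ≤ z.im → z.im ≤ y₂ → z ∈ closure D.carrier)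
    (hh : ∀ z : ℂ, (z.im = y₁ ∨ z.im = y₂) → x₁ ≤ z.re → z.re ≤ x₂ → z ∈ closure D.carrier) :
    (Icc x₁ x₂ ×ℂ Icc y₁ y₂) ⊆ closure D.carrier := by
  rintro z ⟨hre, him⟩
  by_cases h : z ∈ Ioo x₁ x₂ ×ℂ Ioo y₁ y₂
  · exact subset_closure (D.openRect_subset_of_sides_subset_closure hv hh h)
  · rw [Complex.mem_reProdIm, not_and_or] at h
    rcases h with h | h
    · exact hv z (eq_or_eq_of_mem_Icc_of_not_mem_Ioo hre h) him.1 him.2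
    · exact hh z (eq_or_eq_of_mem_Icc_of_not_mem_Ioo him h) hre.1 hre.2

end KernelInnerFaceClosure

open KernelInnerFaceClosure in
/-- **K4 `stub_kernel_innerFace_subset_closure`.** For the discretisation of a JORDAN domain,
the closed mesh square `[δ f₀, δ (f₀ + 1)] × [δ f₁, δ (f₁ + 1)]` of an inner face `f` of `Ω_δ`
lies in the closure of the domain: its four sides do by definition of the mesh graph
(`mem_closure_of_re_eq_side`, `mem_closure_of_im_eq_side`), and a closed axis-parallel rectangle
fenced by `closure D` lies in `closure D` by the Jordan curve theorem
(`closedRect_subset_closure_of_sides`). -/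
theorem stub_kernel_innerFace_subset_closure :
    ∀ (D : JordanDomain) (E : DiscreteDobrushin), E.Ω = D.carrier → 0 < E.δ →
      ∀ f : Site 2, E.IsInnerFace f →
        ∀ p : ℂ, E.δ * (f 0 : ℝ) ≤ p.re → p.re ≤ E.δ * ((f 0 : ℝ) + 1) →
          E.δ * (f 1 : ℝ) ≤ p.im → p.im ≤ E.δ * ((f 1 : ℝ) + 1) → p ∈ closure D.carrier := by
  intro D E hΩ hδ f hf p h1 h2 h3 h4
  refine closedRect_subset_closure_of_sides D (x₁ := E.δ * (f 0 : ℝ)) (x₂ := E.δ * ((f 0 : ℝ) + 1))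
    (y₁ := E.δ * (f 1 : ℝ)) (y₂ := E.δ * ((f 1 : ℝ) + 1)) ?_ ?_ ⟨⟨h1, h2⟩, h3, h4⟩
  · rintro z (hz | hz) hz1 hz2
    · exact hΩ ▸ mem_closure_of_re_eq_side hδ hf (σ := 0) (Or.inl rfl) (by simpa using hz) hz1 hz2
    · exact hΩ ▸ mem_closure_of_re_eq_side hδ hf (σ := 1) (Or.inr rfl) (by simpa using hz) hz1 hz2
  · rintro z (hz | hz) hz1 hz2
    · exact hΩ ▸ mem_closure_of_im_eq_side hδ hf (σ := 0) (Or.inl rfl) (by simpa using hz) hz1 hz2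
    · exact hΩ ▸ mem_closure_of_im_eq_side hδ hf (σ := 1) (Or.inr rfl) (by simpa using hz) hz1 hz2

end Summit.CriticalPhenomena.CardyFormulaZ2.Cruxes.LagHandOff.HittingTournament

end
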